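import Mathlib.RepresentationTheory.Homological.ContCohomology.Functoriality
import Mathlib.NumberTheory.NumberField.Completion.FinitePlace
import Mathlib.NumberTheory.NumberField.Completion.InfinitePlace
import Mathlib.Topology.Algebra.Group.Basic
import Mathlib.Algebra.Group.Subgroup.Actions
import Literature.NumberTheory.EllipticCurves.Selmer
import Literature.NumberTheory.EllipticCurves.TateModule
import Literature.NumberTheory.EllipticCurves.Sha
import Literature.NumberTheory.EllipticCurves.GaloisAction
import HarnessLib

-- provenance: harness21/H21/H21/Prelude/EllArithM/SubgroupSelmer.lean @ 76baec2 (interim HEAD d8f2665); M5 mechanical rewrite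
/-!
# Selmer groups over the fixed field of a normal subgroup of `Γ_K`

Trunk T-ELLARITH-M (group G16, outline item C12a `SubgroupSelmer`, split off from `IwasawaSelmer`);
notions `iwasawa_selmer_module` (part 1), `selmer_group_elliptic`.

Let `K` be a number field, `Γ_K = Gal(K̄/K)` its absolute Galois group, `W` a Weierstrass curve over
`K` and `M = E[p^∞] = W.geomPrimaryTorsion p` (a discrete `Γ_K`-module). For a subgroup `H ≤ Γ_K`
with fixed field `L = K̄^H` (typically `H = Gal(K̄/K_∞)` for a `ℤ_p`-extension `K_∞/K`, or
`H = Gal(K̄/K_n)` for a layer) this file provides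

* the cohomology `H¹(H, M) = H¹_cont(H, M)` of a subgroup (`Literature.NumberTheory.EllipticCurves.subgroupH1`, Mathlib's
  `continuousCohomology 1` for the subspace topology on `H` and the restricted action), the
  restriction maps `H¹(H', M) → H¹(H, M)` for `H ≤ H'` (`Literature.NumberTheory.EllipticCurves.resOfLe`) and, for `H` normal, the
  conjugation action of `σ ∈ Γ_K` on `H¹(H, M)` (`Literature.NumberTheory.EllipticCurves.conjH1`, induced by the compatible pair
  `(h ↦ σ⁻¹ h σ, m ↦ σ • m)`; Serre, *Galois Cohomology*, I.§2.4–2.5, VII.§5 of *Local Fields*);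
* local conditions: for a `K`-field `E` (a completion `K_v`) with restriction `Γ_E → Γ_K`
  (`Literature.resGal E`, file `Sha`), the subgroup `H_E = (Γ_E → Γ_K)⁻¹(H) ≤ Γ_E` (`Literature.NumberTheory.EllipticCurves.localSubgroup`,
  the absolute Galois group of the compositum `L · K_v` for the chosen place of `L` above `v`), the
  restriction `H¹(H, E[p^∞]) → H¹(H_E, E(K̄_E))` (`WeierstrassCurve.localResOver`) and its kernel
  (`WeierstrassCurve.localKerOver`);
* the Selmer group `Sel_{p^∞}(E/L) ⊆ H¹(H, E[p^∞])` (`WeierstrassCurve.selmerGroupOver`): the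
  classes killed by *all `Γ_K`-conjugates* of all local conditions. The places of `L` above a place
  `v` of `K` correspond to the double cosets `H \ Γ_K / D_v`, i.e. to the `Γ_K`-conjugates of the
  chosen decomposition group `D_v = im(Γ_{K_v} → Γ_K)` up to `H`; imposing the local condition after
  conjugating by every `σ ∈ Γ_K` therefore imposes it at every place of `L`
  (Greenberg (1999), §2; Mazur (1972), §6; Milne, *ADT*, I.§6). For `H = ⊤` (`L = K`) conjugation
  acts trivially on `H¹` and one recovers `WeierstrassCurve.selmerGroupPInfty` of file `Selmer`
  (`selmerGroupOver_top`).

Sources: Mazur, *Rational points of abelian varieties with values in towers of number fields*,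
Invent. Math. 18 (1972), §6; Greenberg, *Iwasawa theory for elliptic curves*, LNM 1716 (1999), §1–2;
Serre, *Galois Cohomology*, I.§2.4–2.5 and II.§1; Milne, *Arithmetic Duality Theorems*, I.§6;
Neukirch–Schmidt–Wingberg, *Cohomology of Number Fields*, I.§5 (conjugation on cohomology).

## Mathlib reuse

Continuous cohomology and its functoriality (`continuousCohomology`, `ContinuousCohomology.map`,
`map_id`, `map_comp`) are Mathlib's; so are the subspace topology and `IsTopologicalGroup` instance
on a `Subgroup`, the restricted action `Subgroup.instDistribMulAction…` (`Subgroup.smul_def`),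
`Subgroup.inclusion`, `Subgroup.comap`, `Subgroup.Normal`, `ContinuousMonoidHom`. Mathlib has no
Selmer groups of elliptic curves and no conjugation action on `continuousCohomology` (grep
`Selmer`, `conj` in `RepresentationTheory/Homological/ContCohomology`): the latter is built here
from `ContinuousCohomology.map`.

## Design choices

* Group-wide rules: `noncomputable section`, `open scoped Classical`, no `[DecidableEq]` variables;
  one named universe `u` with `K E G M : Type u` (forced by `ContinuousCohomology.map`).
* Part (a) is written for an arbitrary topological group `G`, subgroup `H ≤ G` and discrete
  `G`-module `M` (namespace `Literature`: `resH1Hom`, `subgroupH1`, `resOfLe`, `conjH1`, …); the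
  Weierstrass-curve versions with `G = Γ_K`, `M = E[p^∞]` are deliberate dot-notation extensions in
  `namespace WeierstrassCurve` (`WeierstrassCurve.subgroupH1 W p H`, `.resOfLe`, `.conjH1`,
  `.localResOver`, `.localKerOver`, `.selmerGroupOver`). The purely Galois-theoretic local subgroup
  `localSubgroup H E ≤ Γ_E` and the restricted map `resGalSubgroup H E : localSubgroup H E →ₜ* H` do
  not depend on `W` and live in `namespace Literature`.
* Variance of conjugation: `Literature.resHomOfEquivariant φ ψ` needs `ψ (φ h • m) = h • ψ m`; with
  `ψ = (σ • ·)` this forces `φ h = σ⁻¹ h σ`. On cocycles `conjH1 H M σ` is the classical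
  `(σ · c)(h) = σ • c(σ⁻¹ h σ)`, a *left* action (`conjH1_mul`).
* As in `Sha`/`Selmer`, every local construction is first made for an arbitrary `K`-embedding
  `ι : K̄ →ₐ[K] K̄_E` (names `…OfEmb`) and then specialised to `closureEmb E`. Unlike the case
  `H = Γ_K`, a single local kernel `localKerOverOfEmb … ι` *does* depend on `ι` (changing `ι` by
  `τ ∈ Γ_K ∖ H` moves to another place of `L` above `v`, i.e. conjugates the kernel by `conjH1 τ`:
  `exists_localKerOverOfEmb_eq_comap`); only the intersection over all conjugates, hence
  `selmerGroupOver`, is choice-free (`selmerGroupOver_eq_of_algHom`).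
* No `[Fact p.Prime]` is assumed: `geomPrimaryTorsion W p = AddCommGroup.primaryComponent _ p` and
  `selmerGroupPInfty` do not need it.
-/

noncomputable section

open scoped Classical

open NumberField IsDedekindDomain

universe u

/-! ## (a) Generic layer: `H¹` of a subgroup, restriction, conjugation -/

namespace Literature.NumberTheory.EllipticCurves

section ResHom

variable {G : Type u} [Group G] [TopologicalSpace G] [IsTopologicalGroup G]
variable {M : Type u} [AddCommGroup M] [DistribMulAction G M] [TopologicalSpace M]
  [DiscreteTopology M]
variable {G' : Type u} [Group G'] [TopologicalSpace G'] [IsTopologicalGroup G']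
variable {N : Type u} [AddCommGroup N] [DistribMulAction G' N] [TopologicalSpace N]
  [DiscreteTopology N]

/-- The map `H¹_cont(G, M) → H¹_cont(G', N)` induced by a compatible pair `(φ : G' → G, ψ : M → N)`
(`ψ (φ x • m) = x • ψ m`), as an additive group homomorphism: Mathlib's `ContinuousCohomology.map`
along `resHomOfEquivariant φ ψ h`, forgetting the `TopModuleCat ℤ` structure.
Serre, *Galois Cohomology*, I.§2.4; Neukirch–Schmidt–Wingberg, I.§5. [folklore] -/
def resH1Hom (φ : G' →ₜ* G) (ψ : M →+ N) (h : ∀ (x : G') (m : M), ψ (φ x • m) = x • ψ m) :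
    discreteH1 G M →+ discreteH1 G' N :=
  (ContinuousCohomology.map φ (resHomOfEquivariant φ ψ h) 1).hom.toLinearMap.toAddMonoidHom

/-- `Literature.resKer φ ψ h` (file `GaloisAction`) is the kernel of `resH1Hom φ ψ h` (definitional).
Serre, *Galois Cohomology*, I.§2.4. [folklore] -/
theorem resKer_eq_ker (φ : G' →ₜ* G) (ψ : M →+ N)
    (h : ∀ (x : G') (m : M), ψ (φ x • m) = x • ψ m) :
    resKer φ ψ h = (resH1Hom φ ψ h).ker :=
  rfl

/-- `resH1Hom` only depends on the compatible pair `(φ, ψ)` (proof-irrelevant congruence, used to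
rewrite the pair under the dependent compatibility hypothesis).
Serre, *Galois Cohomology*, I.§2.4. [folklore] -/
theorem resH1Hom_congr {φ φ' : G' →ₜ* G} {ψ ψ' : M →+ N} (hφ : φ = φ') (hψ : ψ = ψ')
    (h : ∀ (x : G') (m : M), ψ (φ x • m) = x • ψ m)
    (h' : ∀ (x : G') (m : M), ψ' (φ' x • m) = x • ψ' m) :
    resH1Hom φ ψ h = resH1Hom φ' ψ' h' := by
  subst hφ hψ; rfl

/-- The identity pair `(id_G, id_M)` induces the identity of `H¹_cont(G, M)`
(Mathlib's `ContinuousCohomology.map_id`). Serre, *Galois Cohomology*, I.§2.4. [folklore] -/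
theorem resH1Hom_id :
    resH1Hom (ContinuousMonoidHom.id G) (AddMonoidHom.id M) (fun _ _ ↦ rfl) = AddMonoidHom.id _ :=
  congrArg (fun f ↦ f.hom.toLinearMap.toAddMonoidHom)
    (ContinuousCohomology.map_id (discreteTopRep G M) 1)

variable {G'' : Type u} [Group G''] [TopologicalSpace G''] [IsTopologicalGroup G'']
variable {P : Type u} [AddCommGroup P] [DistribMulAction G'' P] [TopologicalSpace P]
  [DiscreteTopology P]

/-- Functoriality of `H¹_cont` in compatible pairs: the map of a composite pair is the composite
of the maps (Mathlib's `ContinuousCohomology.map_comp`).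
Serre, *Galois Cohomology*, I.§2.4; Neukirch–Schmidt–Wingberg, I.§5. [folklore] -/
theorem resH1Hom_comp (φ : G' →ₜ* G) (ψ : M →+ N)
    (h : ∀ (x : G') (m : M), ψ (φ x • m) = x • ψ m)
    (φ' : G'' →ₜ* G') (ψ' : N →+ P)
    (h' : ∀ (x : G'') (n : N), ψ' (φ' x • n) = x • ψ' n) :
    (resH1Hom φ' ψ' h').comp (resH1Hom φ ψ h) =
      resH1Hom (φ.comp φ') (ψ'.comp ψ) (fun x m ↦ by simp [h, h']) :=
  (congrArg (fun f ↦ f.hom.toLinearMap.toAddMonoidHom)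
    (ContinuousCohomology.map_comp (X := discreteTopRep G M) φ φ'
      (resHomOfEquivariant φ ψ h) (resHomOfEquivariant φ' ψ' h') 1)).symm

end ResHom

section Subgroup

variable {G : Type u} [Group G] [TopologicalSpace G] [IsTopologicalGroup G]
variable (H : Subgroup G)
variable (M : Type u) [AddCommGroup M] [DistribMulAction G M] [TopologicalSpace M]
  [DiscreteTopology M]

/-- The continuous cohomology `H¹(H, M) = H¹_cont(H, M)` of a subgroup `H ≤ G` of a topological
group with coefficients in a discrete `G`-module `M` (subspace topology on `H`, action by
restriction `Subgroup.smul_def`; Mathlib's `continuousCohomology 1` through `Literature.NumberTheory.EllipticCurves.discreteH1`). For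
`G = Γ_K` and `H = Gal(K̄/L)` closed this is the Galois cohomology `H¹(L, M)`.
Serre, *Galois Cohomology*, I.§2.2 and I.§2.5. [folklore] -/
abbrev subgroupH1 : Type u :=
  discreteH1 H M

variable {H M}

/-- The inclusion `H ↪ H'` of subgroups `H ≤ H'` of a topological group as a continuous monoid
homomorphism (`Subgroup.inclusion`, `continuous_inclusion`). Serre, *Galois Cohomology*, I.§2.5.
[folklore] -/
def subgroupInclusion {H H' : Subgroup G} (h : H ≤ H') : H →ₜ* H' where
  toMonoidHom := Subgroup.inclusion h
  continuous_toFun := continuous_inclusion h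

omit [IsTopologicalGroup G] in
/-- Unfolding `subgroupInclusion`. Serre, *Galois Cohomology*, I.§2.5. [folklore] -/
@[simp]
theorem subgroupInclusion_apply_coe {H H' : Subgroup G} (h : H ≤ H') (x : H) :
    ((subgroupInclusion h x : H') : G) = x :=
  rfl

variable (M) in
/-- The restriction map `res : H¹(H', M) → H¹(H, M)` for subgroups `H ≤ H'` of `G` (functoriality of
continuous cohomology along the compatible pair `(H ↪ H', id_M)`).
Serre, *Galois Cohomology*, I.§2.5; Neukirch–Schmidt–Wingberg, I.§5. [folklore] -/
def resOfLe {H H' : Subgroup G} (h : H ≤ H') : subgroupH1 H' M →+ subgroupH1 H M :=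
  resH1Hom (subgroupInclusion h) (AddMonoidHom.id M) fun _ _ ↦ rfl

/-- Restriction along `H ≤ H` is the identity (`ContinuousCohomology.map_id`).
Serre, *Galois Cohomology*, I.§2.4; Neukirch–Schmidt–Wingberg, I.§5.
Proved below (`resOfLe_refl_holds`). [cite: NeukirchSchmidtWingberg2008, I.§5] -/
def resOfLe_refl : Prop :=
  ∀ (H : Subgroup G),
    resOfLe M (le_refl H) = AddMonoidHom.id _

/-- `resOfLe_refl` holds: restriction along `H ≤ H` is the identity (from `resH1Hom_id`; the
inclusion `H ↪ H` is definitionally `ContinuousMonoidHom.id H`).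
Neukirch–Schmidt–Wingberg, I.§5. [folklore] -/
theorem resOfLe_refl_holds : resOfLe_refl (G := G) (M := M) :=
  fun _ ↦ resH1Hom_id

/-- Transitivity of restriction: for `H ≤ H' ≤ H''`, `res_{H'/H} ∘ res_{H''/H'} = res_{H''/H}`
(`ContinuousCohomology.map_comp`). Serre, *Galois Cohomology*, I.§2.4;
Neukirch–Schmidt–Wingberg, I.§5. Proved below (`resOfLe_comp_holds`).
[cite: NeukirchSchmidtWingberg2008, I.§5] -/
def resOfLe_comp : Prop :=
  ∀ {H H' H'' : Subgroup G} (h : H ≤ H') (h' : H' ≤ H''),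
    (resOfLe M h).comp (resOfLe M h') = resOfLe M (h.trans h')

/-- `resOfLe_comp` holds (from `resH1Hom_comp`). Neukirch–Schmidt–Wingberg, I.§5. [folklore] -/
theorem resOfLe_comp_holds : resOfLe_comp (G := G) (M := M) :=
  fun _ _ ↦ resH1Hom_comp _ _ _ _ _ _

variable (H)

omit [TopologicalSpace G] [IsTopologicalGroup G] in
/-- A normal subgroup is stable under `x ↦ σ⁻¹ x σ` (`Subgroup.Normal.conj_mem` with `σ⁻¹`).
Serre, *Galois Cohomology*, I.§2.5. [folklore] -/
theorem conj_mem_of_normal [hH : H.Normal] (σ : G) (x : H) : σ⁻¹ * x * σ ∈ H := by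
  simpa only [inv_inv] using hH.conj_mem (x : G) x.2 σ⁻¹

/-- Conjugation `h ↦ σ⁻¹ h σ` on a normal subgroup `H` of a topological group, as a continuous
monoid homomorphism `H →ₜ* H` (the variance is the one making `(σ⁻¹ (·) σ, σ • ·)` a compatible
pair, see `conjH1`). Serre, *Galois Cohomology*, I.§2.5; Neukirch–Schmidt–Wingberg, I.§5.
[folklore] -/
def subgroupConj [H.Normal] (σ : G) : H →ₜ* H where
  toFun x := ⟨σ⁻¹ * x * σ, conj_mem_of_normal H σ x⟩
  map_one' := Subtype.ext (by simp)
  map_mul' x y := Subtype.ext (by simp [mul_assoc])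
  continuous_toFun := by
    refine Continuous.subtype_mk ?_ _
    exact (continuous_const.mul continuous_subtype_val).mul continuous_const

/-- Unfolding `subgroupConj`: `subgroupConj H σ x = σ⁻¹ x σ`. Serre, *Galois Cohomology*, I.§2.5.
[folklore] -/
@[simp]
theorem subgroupConj_apply_coe [H.Normal] (σ : G) (x : H) :
    ((subgroupConj H σ x : H) : G) = σ⁻¹ * x * σ :=
  rfl

/-- Conjugation by `1` is the identity of `H`. Serre, *Galois Cohomology*, I.§2.5. [folklore] -/
@[simp]
theorem subgroupConj_one [H.Normal] : subgroupConj H (1 : G) = ContinuousMonoidHom.id H := by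
  ext x; simp

/-- `subgroupConj` is contravariant: `conj_τ ∘ conj_σ = conj_{στ}` (as maps `h ↦ σ⁻¹ h σ`).
Serre, *Galois Cohomology*, I.§2.5. [folklore] -/
theorem subgroupConj_comp [H.Normal] (σ τ : G) :
    (subgroupConj H τ).comp (subgroupConj H σ) = subgroupConj H (σ * τ) := by
  ext x; simp [mul_assoc]

variable (M)

/-- The conjugation action of `σ ∈ G` on `H¹(H, M)` for a normal subgroup `H`: the map induced by
the compatible pair `(H → H, h ↦ σ⁻¹ h σ; M → M, m ↦ σ • m)`; on cocycles
`(σ · c)(h) = σ • c(σ⁻¹ h σ)`. For `G = Γ_K`, `H = Gal(K̄/L)` this is the action of `Gal(L/K)` on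
`H¹(L, M)` making the Selmer group over a `ℤ_p`-extension a `Λ`-module.
Serre, *Galois Cohomology*, I.§2.5 and *Local Fields*, VII.§5; Neukirch–Schmidt–Wingberg, I.§5;
Greenberg (1999), §1. [cite: GreenbergLNM1716, §1] -/
def conjH1 [H.Normal] (σ : G) : subgroupH1 H M →+ subgroupH1 H M :=
  resH1Hom (subgroupConj H σ) (DistribSMul.toAddMonoidHom M σ) fun x m ↦ by
    simp only [DistribSMul.toAddMonoidHom_apply, Subgroup.smul_def, subgroupConj_apply_coe,
      smul_smul, mul_assoc, mul_inv_cancel_left]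

/-- Conjugation by `1` is the identity on `H¹(H, M)` (`ContinuousCohomology.map_id`).
Serre, *Galois Cohomology*, I.§2.5; Neukirch–Schmidt–Wingberg, I.§5. Proved below
(`conjH1_one_holds`). [cite: NeukirchSchmidtWingberg2008, I.§5] -/
def conjH1_one : Prop :=
  ∀ [H.Normal],
    conjH1 H M (1 : G) = AddMonoidHom.id _

/-- `conjH1_one` holds (from `resH1Hom_id` and `subgroupConj_one`).
Neukirch–Schmidt–Wingberg, I.§5. [folklore] -/
theorem conjH1_one_holds : conjH1_one H M := by
  intro _
  rw [conjH1, resH1Hom_congr (ψ' := AddMonoidHom.id M) (subgroupConj_one H) (by ext; simp) _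
    (fun _ _ ↦ rfl), resH1Hom_id]

/-- Conjugation is a left action on `H¹(H, M)`: `conj_{στ} = conj_σ ∘ conj_τ`
(`ContinuousCohomology.map_comp`). Serre, *Galois Cohomology*, I.§2.5;
Neukirch–Schmidt–Wingberg, I.§5. Proved below (`conjH1_mul_holds`).
[cite: NeukirchSchmidtWingberg2008, I.§5] -/
def conjH1_mul : Prop :=
  ∀ [H.Normal] (σ τ : G),
    conjH1 H M (σ * τ) = (conjH1 H M σ).comp (conjH1 H M τ)

/-- `conjH1_mul` holds (from `resH1Hom_comp` and `subgroupConj_comp`).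
Neukirch–Schmidt–Wingberg, I.§5. [folklore] -/
theorem conjH1_mul_holds : conjH1_mul H M := by
  intro _ σ τ
  rw [conjH1, conjH1, conjH1, resH1Hom_comp]
  exact (resH1Hom_congr (subgroupConj_comp H σ τ) (by ext; simp [mul_smul]) _ _).symm

/-- Inner automorphisms act trivially on cohomology: for `σ ∈ H`, conjugation by `σ` is the identity
of `H¹(H, M)`; hence `conjH1` factors through `G / H`.
Serre, *Galois Cohomology*, I.§2.5 (before Prop. 3) and *Local Fields*, VII.§5, Prop. 3;
Neukirch–Schmidt–Wingberg, (1.6.3). [cite: SerreLocalFields1979, VII.§5 Prop. 3] -/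
def conjH1_of_mem : Prop :=
  ∀ [H.Normal] {σ : G} (_ : σ ∈ H),
    conjH1 H M σ = AddMonoidHom.id _

/-- Conjugation commutes with restriction: for normal subgroups `H ≤ H'`,
`res ∘ conj_σ = conj_σ ∘ res`. Serre, *Galois Cohomology*, I.§2.5; Neukirch–Schmidt–Wingberg,
I.§5. Proved below (`resOfLe_comp_conjH1_holds`). [cite: NeukirchSchmidtWingberg2008, I.§5] -/
def resOfLe_comp_conjH1 : Prop :=
  ∀ {H H' : Subgroup G} [H.Normal] [H'.Normal] (h : H ≤ H') (σ : G),
    (resOfLe M h).comp (conjH1 H' M σ) = (conjH1 H M σ).comp (resOfLe M h)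

/-- `resOfLe_comp_conjH1` holds: both composites are induced by the same compatible pair
`(h ↦ σ⁻¹ h σ : H → H', σ • ·)` (`resH1Hom_comp`). Neukirch–Schmidt–Wingberg, I.§5. [folklore] -/
theorem resOfLe_comp_conjH1_holds : resOfLe_comp_conjH1 (G := G) (M := M) := by
  intro H H' _ _ h σ
  rw [conjH1, conjH1, resOfLe, resH1Hom_comp, resH1Hom_comp]
  exact resH1Hom_congr (by ext; simp) (by ext; simp) _ _

end Subgroup

end Literature.NumberTheory.EllipticCurves

/-! ## (b) Local subgroups `H_E = (Γ_E → Γ_K)⁻¹(H)` -/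

namespace Literature.NumberTheory.EllipticCurves

section Local

variable {K : Type u} [Field K] (H : Subgroup (Field.absoluteGaloisGroup K))
variable {E : Type u} [Field E] [Algebra K E]
variable (ι : AlgebraicClosure K →ₐ[K] AlgebraicClosure E)

/-- The local subgroup `H_E ≤ Γ_E` attached to `H ≤ Γ_K` and a `K`-embedding `ι : K̄ → K̄_E`: the
preimage of `H` under the restriction `resGalOfEmb ι : Γ_E → Γ_K`. For `E = K_v` and `H = Gal(K̄/L)`
this is `Gal(K̄_v / L·K_v)`, the absolute Galois group of the completion of `L` at the place above
`v` singled out by `ι`. Serre, *Galois Cohomology*, II.§1.1; Greenberg (1999), §2. [cite: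
GreenbergLNM1716, §2] -/
def localSubgroupOfEmb : Subgroup (Field.absoluteGaloisGroup E) :=
  H.comap (resGalOfEmb ι).toMonoidHom

/-- Membership in `localSubgroupOfEmb`. Serre, *Galois Cohomology*, II.§1.1. [folklore] -/
theorem mem_localSubgroupOfEmb_iff (τ : Field.absoluteGaloisGroup E) :
    τ ∈ localSubgroupOfEmb H ι ↔ resGalOfEmb ι τ ∈ H :=
  Iff.rfl

/-- The restriction `Γ_E → Γ_K` attached to `ι`, restricted and corestricted to a continuous monoid
homomorphism `H_E →ₜ* H`. Serre, *Galois Cohomology*, II.§1.1. [folklore] -/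
def resGalSubgroupOfEmb : localSubgroupOfEmb H ι →ₜ* H where
  toFun τ := ⟨resGalOfEmb ι τ, τ.2⟩
  map_one' := Subtype.ext (map_one _)
  map_mul' _ _ := Subtype.ext (map_mul _ _ _)
  continuous_toFun :=
    ((map_continuous (resGalOfEmb ι)).comp continuous_subtype_val).subtype_mk _

/-- Unfolding `resGalSubgroupOfEmb`. Serre, *Galois Cohomology*, II.§1.1. [folklore] -/
@[simp]
theorem resGalSubgroupOfEmb_apply_coe (τ : localSubgroupOfEmb H ι) :
    ((resGalSubgroupOfEmb H ι τ : H) : Field.absoluteGaloisGroup K) = resGalOfEmb ι τ :=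
  rfl

variable (E)

/-- The local subgroup `H_E = (resGal E)⁻¹(H) ≤ Γ_E` for the chosen embedding `closureEmb E`
(`= localSubgroupOfEmb H (closureEmb E)`). Serre, *Galois Cohomology*, II.§1.1; Greenberg (1999),
§2. [cite: GreenbergLNM1716, §2] -/
def localSubgroup : Subgroup (Field.absoluteGaloisGroup E) :=
  localSubgroupOfEmb H (closureEmb (K := K) E)

/-- Membership in `localSubgroup`: `τ ∈ H_E ↔ resGal E τ ∈ H`. Serre, *Galois Cohomology*, II.§1.1.
[folklore] -/
theorem mem_localSubgroup_iff (τ : Field.absoluteGaloisGroup E) :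
    τ ∈ localSubgroup H E ↔ resGal (K := K) E τ ∈ H :=
  Iff.rfl

/-- `localSubgroup H E` is the preimage of `H` under `resGal E`. Serre, *Galois Cohomology*,
II.§1.1. [folklore] -/
theorem localSubgroup_eq_comap :
    localSubgroup H E = H.comap (resGal (K := K) E).toMonoidHom :=
  rfl

/-- The local subgroup of `⊤` is `⊤`. Serre, *Galois Cohomology*, II.§1.1. [folklore] -/
@[simp]
theorem localSubgroup_top : localSubgroup (⊤ : Subgroup (Field.absoluteGaloisGroup K)) E = ⊤ :=
  Subgroup.comap_top _

/-- The restriction `resGal E : Γ_E → Γ_K`, (co)restricted to `H_E →ₜ* H`, for the chosen embedding.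
Serre, *Galois Cohomology*, II.§1.1. [folklore] -/
def resGalSubgroup : localSubgroup H E →ₜ* H :=
  resGalSubgroupOfEmb H (closureEmb (K := K) E)

/-- Unfolding `resGalSubgroup`. Serre, *Galois Cohomology*, II.§1.1. [folklore] -/
@[simp]
theorem resGalSubgroup_apply_coe (τ : localSubgroup H E) :
    ((resGalSubgroup H E τ : H) : Field.absoluteGaloisGroup K) = resGal (K := K) E τ :=
  rfl

end Local

end Literature.NumberTheory.EllipticCurves

/-! ## Weierstrass curves: `H¹(H, E[p^∞])`, local kernels and `Sel_{p^∞}(E/L)` -/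

namespace WeierstrassCurve

open Literature.NumberTheory.EllipticCurves

variable {K : Type u} [Field K] (W : WeierstrassCurve K) (p : ℕ)

/-- The cohomology group `H¹(H, E[p^∞]) = H¹_cont(H, E(K̄)[p^∞])` of a subgroup `H ≤ Γ_K` with
coefficients in the `p`-primary torsion of `W` (`Literature.subgroupH1 H (geomPrimaryTorsion W p)`). For
`H = Gal(K̄/L)` this is `H¹(L, E[p^∞])`. Greenberg (1999), §1–2; Serre, *Galois Cohomology*, II.§1.
[cite: GreenbergLNM1716, §1–2] -/
abbrev subgroupH1 (H : Subgroup (Field.absoluteGaloisGroup K)) : Type u :=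
  Literature.NumberTheory.EllipticCurves.subgroupH1 H (geomPrimaryTorsion W p)

/-- Restriction `H¹(H', E[p^∞]) → H¹(H, E[p^∞])` for `H ≤ H'` (`Literature.NumberTheory.EllipticCurves.resOfLe`); e.g. the maps
`H¹(K_n, E[p^∞]) → H¹(K_∞, E[p^∞])` of a `ℤ_p`-tower. Greenberg (1999), §1; Serre, *Galois
Cohomology*, I.§2.5. [cite: GreenbergLNM1716, §1] -/
abbrev resOfLe {H H' : Subgroup (Field.absoluteGaloisGroup K)} (h : H ≤ H') :
    W.subgroupH1 p H' →+ W.subgroupH1 p H :=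
  Literature.NumberTheory.EllipticCurves.resOfLe (geomPrimaryTorsion W p) h

/-- The conjugation action of `σ ∈ Γ_K` on `H¹(H, E[p^∞])` for `H` normal (`Literature.NumberTheory.EllipticCurves.conjH1`): the action
of `Gal(L/K)` on `H¹(L, E[p^∞])`, `L = K̄^H`. Greenberg (1999), §1; Mazur (1972), §6. [cite:
GreenbergLNM1716, §1] -/
abbrev conjH1 (H : Subgroup (Field.absoluteGaloisGroup K)) [H.Normal]
    (σ : Field.absoluteGaloisGroup K) : W.subgroupH1 p H →+ W.subgroupH1 p H :=
  Literature.NumberTheory.EllipticCurves.conjH1 H (geomPrimaryTorsion W p) σ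

variable (H : Subgroup (Field.absoluteGaloisGroup K))

/-- `conj_1 = id` on `H¹(H, E[p^∞])`. Serre, *Galois Cohomology*, I.§2.5. [folklore] -/
def conjH1_one : Prop :=
  ∀ [H.Normal],
    W.conjH1 p H 1 = AddMonoidHom.id _

/- interim proof relied on results that are now named facts (D-0014); demoted to a fact by the
M5 import, proof preserved:
:=
  Literature.conjH1_one H _
-/

/-- `conjH1_one` holds for `H¹(H, E[p^∞])` (`Literature.NumberTheory.EllipticCurves.conjH1_one_holds`).
Serre, *Galois Cohomology*, I.§2.5. [folklore] -/
theorem conjH1_one_holds : W.conjH1_one p H :=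
  Literature.NumberTheory.EllipticCurves.conjH1_one_holds H _

/-- `conj_{στ} = conj_σ ∘ conj_τ` on `H¹(H, E[p^∞])`. Serre, *Galois Cohomology*, I.§2.5.
[folklore] -/
def conjH1_mul : Prop :=
  ∀ [H.Normal] (σ τ : Field.absoluteGaloisGroup K),
    W.conjH1 p H (σ * τ) = (W.conjH1 p H σ).comp (W.conjH1 p H τ)

/- interim proof relied on results that are now named facts (D-0014); demoted to a fact by the
M5 import, proof preserved:
:=
  Literature.conjH1_mul H _ σ τ
-/

/-- `conjH1_mul` holds for `H¹(H, E[p^∞])` (`Literature.NumberTheory.EllipticCurves.conjH1_mul_holds`).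
Serre, *Galois Cohomology*, I.§2.5. [folklore] -/
theorem conjH1_mul_holds : W.conjH1_mul p H :=
  fun σ τ ↦ Literature.NumberTheory.EllipticCurves.conjH1_mul_holds H _ σ τ

/-- Elements of `H` act trivially on `H¹(H, E[p^∞])`. Serre, *Galois Cohomology*, I.§2.5.
[folklore] -/
def conjH1_of_mem : Prop :=
  ∀ [H.Normal] {σ : Field.absoluteGaloisGroup K} (_ : σ ∈ H),
    W.conjH1 p H σ = AddMonoidHom.id _

/- interim proof relied on results that are now named facts (D-0014); demoted to a fact by the
M5 import, proof preserved:
:=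
  Literature.conjH1_of_mem H _ hσ
-/

/-- `conjH1_of_mem` for `H¹(H, E[p^∞])` follows from the generic named fact `Literature.NumberTheory.EllipticCurves.conjH1_of_mem`
(inner automorphisms act trivially). Serre, *Local Fields*, VII.§5, Prop. 3. [folklore] -/
theorem conjH1_of_mem_of (h : Literature.NumberTheory.EllipticCurves.conjH1_of_mem H (geomPrimaryTorsion W p)) : W.conjH1_of_mem p H :=
  fun hσ ↦ h hσ

/-- Transitivity of restriction on `H¹(·, E[p^∞])`. Serre, *Galois Cohomology*, I.§2.5. [folklore]
-/
def resOfLe_comp : Prop :=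
  ∀ {H H' H'' : Subgroup (Field.absoluteGaloisGroup K)} (h : H ≤ H') (h' : H' ≤ H''),
    (W.resOfLe p h).comp (W.resOfLe p h') = W.resOfLe p (h.trans h')

/- interim proof relied on results that are now named facts (D-0014); demoted to a fact by the
M5 import, proof preserved:
:=
  Literature.resOfLe_comp h h'
-/

/-- `resOfLe_comp` holds for `H¹(·, E[p^∞])` (`Literature.NumberTheory.EllipticCurves.resOfLe_comp_holds`).
Serre, *Galois Cohomology*, I.§2.5. [folklore] -/
theorem resOfLe_comp_holds : W.resOfLe_comp p :=
  fun h h' ↦ Literature.NumberTheory.EllipticCurves.resOfLe_comp_holds (M := geomPrimaryTorsion W p) h h'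

section Local

variable {E : Type u} [Field E] [Algebra K E]
variable (ι : AlgebraicClosure K →ₐ[K] AlgebraicClosure E)

/-- The local restriction `H¹(H, E[p^∞]) → H¹(H_E, E(K̄_E))` attached to a `K`-embedding
`ι : K̄ → K̄_E`, along the compatible pair `(resGalSubgroupOfEmb H ι : H_E → H,
pointsMapOfEmb ι ∘ (E[p^∞] ↪
E(K̄)))`. Greenberg (1999), §2; Milne, *ADT*, I.§6. [cite: GreenbergLNM1716, §2] -/
def localResOverOfEmb :
    W.subgroupH1 p H →+ discreteH1 (localSubgroupOfEmb H ι) (localPoints W E) :=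
  resH1Hom (resGalSubgroupOfEmb H ι)
    ((pointsMapOfEmb W ι).comp (geomPrimaryTorsion W p).subtype) fun τ P ↦ by
    simp only [AddMonoidHom.coe_comp, AddSubgroup.coe_subtype, Function.comp_apply,
      Subgroup.smul_def, resGalSubgroupOfEmb_apply_coe, Literature.NumberTheory.EllipticCurves.primaryComponent.coe_smul]
    exact pointsMapOfEmb_smul W ι τ P

/-- The local kernel at `E` over `L = K̄^H` attached to `ι`: the classes in `H¹(H, E[p^∞])` dying in
`H¹(H_E, E(K̄_E))`. Greenberg (1999), §2; Milne, *ADT*, I.§6. [cite: GreenbergLNM1716, §2] -/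
def localKerOverOfEmb : AddSubgroup (W.subgroupH1 p H) :=
  (W.localResOverOfEmb p H ι).ker

variable (E)

/-- The local restriction `H¹(H, E[p^∞]) → H¹(H_E, E(K̄_E))` for the chosen embedding
`closureEmb E`. Greenberg (1999), §2; Milne, *ADT*, I.§6. [cite: GreenbergLNM1716, §2] -/
def localResOver : W.subgroupH1 p H →+ discreteH1 (localSubgroup H E) (localPoints W E) :=
  W.localResOverOfEmb p H (closureEmb (K := K) E)

/-- The local kernel at `E` over `L = K̄^H` (chosen embedding): the local condition at the chosen
place of `L` above the place of `K` with completion `E`. Greenberg (1999), §2; Milne, *ADT*, I.§6.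
[cite: GreenbergLNM1716, §2] -/
def localKerOver : AddSubgroup (W.subgroupH1 p H) :=
  (W.localResOver p H E).ker

/-- Membership in the local kernel. Greenberg (1999), §2. [cite: GreenbergLNM1716, §2] -/
theorem mem_localKerOver_iff (c : W.subgroupH1 p H) :
    c ∈ W.localKerOver p H E ↔ W.localResOver p H E c = 0 :=
  Iff.rfl

/-- `localKerOver` is `localKerOverOfEmb` at `closureEmb E` (definitional). Greenberg (1999), §2.
[cite: GreenbergLNM1716, §2] -/
theorem localKerOver_eq_ofEmb :
    W.localKerOver p H E = W.localKerOverOfEmb p H (closureEmb (K := K) E) :=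
  rfl

variable {E}

/-- Dependence on the embedding: replacing `closureEmb E` by another `K`-embedding `ι : K̄ → K̄_E`
(`ι = closureEmb E ∘ τ` for some `τ ∈ Γ_K`) replaces the local kernel by its conjugate under
`conjH1 τ` — the local condition at another place of `L = K̄^H` above the same place of `K`.
Serre, *Galois Cohomology*, II.§1.1 and I.§2.5; Greenberg (1999), §2. [cite: GreenbergLNM1716, §2]
-/
def exists_localKerOverOfEmb_eq_comap : Prop :=
  ∀ [H.Normal],
    ∃ τ : Field.absoluteGaloisGroup K,
      W.localKerOverOfEmb p H ι = (W.localKerOver p H E).comap (W.conjH1 p H τ)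

end Local

/-! ## The Selmer group over `L = K̄^H` -/

section NumberField

variable [NumberField K] [H.Normal]

/-- The **`p^∞`-Selmer group over `L = K̄^H`**, `Sel_{p^∞}(E/L) ⊆ H¹(H, E[p^∞])`, for a normal
subgroup `H ≤ Γ_K` of the absolute Galois group of a number field: the classes `c` such that
`conj_σ c` dies in `H¹(H_{K_v}, E(K̄_v))` for every finite place `v` (`K_v = v.adicCompletion K`),
every infinite place `w` (`K_w = w.Completion`) and every `σ ∈ Γ_K`. Since the places of `L` above
`v` are the `Γ_K`-conjugates (modulo `H`) of the chosen decomposition group, this imposes the local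
condition at *every* place of `L`; for `L/K` infinite it is the usual
`Sel_{p^∞}(E/L) = lim→ Sel(E/Lₙ)`. For `H = ⊤` it is `selmerGroupPInfty W p`
(`selmerGroupOver_top`). Mazur (1972), §6; Greenberg (1999), §1–2; Milne, *ADT*, I.§6. [cite:
MazurInvent1972, §6] -/
def selmerGroupOver : AddSubgroup (W.subgroupH1 p H) :=
  (⨅ (v : HeightOneSpectrum (𝓞 K)) (σ : Field.absoluteGaloisGroup K),
      (W.localKerOver p H (v.adicCompletion K)).comap (W.conjH1 p H σ)) ⊓
    ⨅ (w : InfinitePlace K) (σ : Field.absoluteGaloisGroup K),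
      (W.localKerOver p H w.Completion).comap (W.conjH1 p H σ)

/-- Membership in `Sel_{p^∞}(E/L)`. Greenberg (1999), §2. [cite: GreenbergLNM1716, §2] -/
theorem mem_selmerGroupOver_iff (c : W.subgroupH1 p H) :
    c ∈ W.selmerGroupOver p H ↔
      (∀ (v : HeightOneSpectrum (𝓞 K)) (σ : Field.absoluteGaloisGroup K),
          W.conjH1 p H σ c ∈ W.localKerOver p H (v.adicCompletion K)) ∧
        ∀ (w : InfinitePlace K) (σ : Field.absoluteGaloisGroup K),
          W.conjH1 p H σ c ∈ W.localKerOver p H w.Completion := by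
  simp only [selmerGroupOver, AddSubgroup.mem_inf, AddSubgroup.mem_iInf, AddSubgroup.mem_comap]

/-- `Sel_{p^∞}(E/L)` is stable under the conjugation action of `Γ_K` (from `conjH1_mul`: the set of
conditions is permuted by `γ`). This makes `Sel_{p^∞}(E/K_∞)` a `Λ`-module in `IwasawaSelmer`.
Mazur (1972), §6; Greenberg (1999), §1. [cite: MazurInvent1972, §6] -/
def map_conjH1_selmerGroupOver_le : Prop :=
  ∀ (γ : Field.absoluteGaloisGroup K),
    (W.selmerGroupOver p H).map (W.conjH1 p H γ) ≤ W.selmerGroupOver p H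

/-- `Sel_{p^∞}(E/L)` does not depend on the choices of embeddings `K̄ → K̄_v`: replacing them by
arbitrary `K`-embeddings `ι v`, `ι' w` (and still intersecting over all conjugates) gives the same
subgroup. Serre, *Galois Cohomology*, II.§1.1; Greenberg (1999), §2. [cite: GreenbergLNM1716, §2] -/
def selmerGroupOver_eq_of_algHom : Prop :=
  ∀ (ι : ∀ v : HeightOneSpectrum (𝓞 K),
      AlgebraicClosure K →ₐ[K] AlgebraicClosure (v.adicCompletion K))
    (ι' : ∀ w : InfinitePlace K, AlgebraicClosure K →ₐ[K] AlgebraicClosure w.Completion),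
    W.selmerGroupOver p H =
      (⨅ (v : HeightOneSpectrum (𝓞 K)) (σ : Field.absoluteGaloisGroup K),
          (W.localKerOverOfEmb p H (ι v)).comap (W.conjH1 p H σ)) ⊓
        ⨅ (w : InfinitePlace K) (σ : Field.absoluteGaloisGroup K),
          (W.localKerOverOfEmb p H (ι' w)).comap (W.conjH1 p H σ)

omit [H.Normal] in
/-- Compatibility with file `Selmer`: for `H = ⊤ = Γ_K` (so `L = K`; conjugation is trivial on `H¹`
by `conjH1_of_mem`) the Selmer group over `L` is the `p^∞`-Selmer group `Sel_{p^∞}(E/K)`, along the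
isomorphism `H¹(⊤, E[p^∞]) ≃ H¹(Γ_K, E[p^∞])` induced by `Subgroup.topEquiv`.
Greenberg (1999), §2; Milne, *ADT*, I.§6. [cite: GreenbergLNM1716, §2] -/
def selmerGroupOver_top : Prop :=
  Nonempty (W.selmerGroupOver p (⊤ : Subgroup (Field.absoluteGaloisGroup K)) ≃+
      W.selmerGroupPInfty p)

end NumberField

end WeierstrassCurve
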